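import Mathlib
import Summits.KontsevichZagierPeriods.KontsevichZagierPeriods.Theorems.SoloInformedSumChart
import HarnessLib
import HarnessLib.Audit

/-!
# SoloInformed — the pieces of the garland are the double zeta values (PROGRAMME XXXIX, file 3)

Solo programme `solo-KontsevichZagierPeriods-informed`, session s46. Dimension `n = m + 4`.
The linear extensions of the garland poset `E` (chain `t₀ > ⋯ > t_{m+2}`, pendant `t_{m+3} < t₀`)
are indexed by the SLOT `s ∈ {1, …, m+3}` (rank from the top) at which the pendant coordinate is
inserted into the chain: the coordinate-to-slot map of a compatible `σ` is `Fin.succAbove s` on the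
chain and `s` on the pendant (`soloInformed_sumCompat_cellPerm_castSucc`). Reading the letters of
the garland form `g = ∏ ω_{εᵢ}(tᵢ)` in slot order gives the word with `1`s exactly at `s` and at the
slot of the chain bottom, i.e. the word of

  `Z(s+1, m+3−s)` for `1 ≤ s ≤ m+2`,   and   `Z(m+3, 1)` for `s = m+3`.

Main results: `soloInformed_sumPiece_class` (each simplex piece IS that double zeta class in `𝒫`),
the bijection `σ ↔ s` (`soloInformedSumSigma`), and
`soloInformed_sum_R1_class : ⟦R₁⟧ = ∑_{s ≠ 0} mzvClass (idx s)` in the formal period ring.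

References: Kontsevich–Zagier 2001 §1.2 [KontsevichZagier2001]; S. Yamamoto, arXiv:1405.6499, §2
(the integral of a 2-poset as a sum over linear extensions); Hoffman 1992 (sum formula).
-/

noncomputable section

open MeasureTheory Set MvPolynomial
open Literature.ModelTheory.ExponentialFields Literature.NumberTheory.Transcendental
open Literature.NumberTheory.Transcendental.KZ

namespace Summit.KontsevichZagierPeriods.KontsevichZagierPeriods.Theorems

variable {m : ℕ}

/-! ## 1. Classes of simplex representations with a prescribed word -/

/-- A representation on Kontsevich's simplex whose integrand is the word-product of an admissible
index `u` has class `mzvClass u` — in any dimension `N = |u|` (the cast is absorbed by `subst`). -/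
theorem soloInformed_toFormalPeriod_eq_mzvClass {u : List ℕ} (hu : MZV.IsAdmissible u) {N : ℕ}
    (h : MZV.weight u = N) (r : IntegralRep N) (hd : r.domain = openOrderedSimplex N)
    (hi : ∀ w, r.integrand w = ∏ k : Fin N, mzvForm ((MZV.binaryWord u).getD k false) (w k)) :
    toFormalPeriod (of r) = mzvClass u := by
  subst h
  rw [mzvClass_of_isAdmissible hu, toFormalPeriod_eq_iff]
  refine of_sub_of_mem_relations_of_eqOn ?_ fun w _ => ?_
  · rw [hd]; rfl
  · rw [hi]; rfl

/-! ## 2. The word of a pair -/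

/-- `getD` through a block of `false`s. -/
theorem soloInformed_getD_replicate_false_append (n : ℕ) (l : List Bool) (k : ℕ) :
    (List.replicate n false ++ l).getD k false = if k < n then false else l.getD (k - n) false := by
  induction n generalizing k with
  | zero => simp
  | succ n ih =>
    cases k with
    | zero => simp [List.replicate_succ]
    | succ k =>
      rw [List.replicate_succ, List.cons_append, List.getD_cons_succ, ih]
      simp only [Nat.succ_lt_succ_iff, Nat.succ_sub_succ]

/-- **The word of `Z(a,b)`**: letter `1` exactly at positions `a − 1` and `a + b − 1`. -/
theorem soloInformed_binaryWord_pair_getD (a b k : ℕ) (ha : 1 ≤ a) (hb : 1 ≤ b) :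
    (MZV.binaryWord [a, b]).getD k false = decide (k = a - 1 ∨ k = a + b - 1) := by
  have hw : MZV.binaryWord [a, b] =
      List.replicate (a - 1) false ++ (true :: (List.replicate (b - 1) false ++ [true])) := by
    simp [MZV.binaryWord]
  rw [hw, soloInformed_getD_replicate_false_append]
  split_ifs with h1
  · symm; simp only [decide_eq_false_iff_not, not_or]; omega
  · rcases Nat.eq_zero_or_eq_succ_pred (k - (a - 1)) with h2 | h2
    · rw [h2, List.getD_cons_zero]; symm; simp only [decide_eq_true_eq]; omega
    · rw [h2, List.getD_cons_succ, soloInformed_getD_replicate_false_append]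
      split_ifs with h3
      · symm; simp only [decide_eq_false_iff_not, not_or]; omega
      · rcases Nat.eq_zero_or_eq_succ_pred (Nat.pred (k - (a - 1)) - (b - 1)) with h4 | h4
        · rw [h4, List.getD_cons_zero]; symm; simp only [decide_eq_true_eq]; omega
        · rw [h4, List.getD_cons_succ, List.getD_nil]; symm
          simp only [decide_eq_false_iff_not, not_or]; omega

/-! ## 3. The index attached to a slot -/

/-- The slot of the chain bottom `t_{m+2}` when the pendant sits at slot `s`. -/
def soloInformedSumQslot (s : Fin (m + 4)) : Fin (m + 4) :=
  if s = Fin.last (m + 3) then Fin.castSucc (Fin.last (m + 2)) else Fin.last (m + 3)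

/-- The double-zeta index attached to the slot `s` of the pendant:
`(s+1, m+3−s)` for `s ≤ m+2`, `(m+3, 1)` for `s = m+3`. -/
def soloInformedSumIdx (m : ℕ) (s : Fin (m + 4)) : List ℕ :=
  if s = Fin.last (m + 3) then [m + 3, 1] else [s.1 + 1, m + 3 - s.1]

/-- The attached index is admissible (for `s ≠ 0`). -/
theorem soloInformed_sumIdx_admissible {s : Fin (m + 4)} (hs : s ≠ 0) :
    MZV.IsAdmissible (soloInformedSumIdx m s) := by
  have hs' : (s : ℕ) ≠ 0 := fun e => hs (Fin.ext (by simpa using e))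
  unfold soloInformedSumIdx
  split_ifs with h
  · refine ⟨fun i hi => ?_, fun _ => ?_⟩
    · simp at hi; omega
    · simp
  · have := Fin.val_lt_last h
    refine ⟨fun i hi => ?_, fun _ => ?_⟩
    · simp at hi; omega
    · simp; omega

/-- The attached index has weight `m + 4`. -/
theorem soloInformed_sumIdx_weight (s : Fin (m + 4)) : MZV.weight (soloInformedSumIdx m s) = m + 4 := by
  have := s.2
  unfold soloInformedSumIdx MZV.weight
  split_ifs with h
  · simp
  · simp; omega

/-- **The word of the attached index**: `1`s exactly at the slots `s` and `q(s)`. -/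
theorem soloInformed_sumIdx_getD {s : Fin (m + 4)} (hs : s ≠ 0) (k : Fin (m + 4)) :
    (MZV.binaryWord (soloInformedSumIdx m s)).getD k false =
      decide (k = s ∨ k = soloInformedSumQslot s) := by
  have hs' : (s : ℕ) ≠ 0 := fun e => hs (Fin.ext (by simpa using e))
  have hk := k.2
  unfold soloInformedSumIdx soloInformedSumQslot
  split_ifs with h
  · subst h
    rw [soloInformed_binaryWord_pair_getD _ _ _ (by omega) le_rfl]
    refine decide_eq_decide.mpr ?_
    simp only [Fin.ext_iff, Fin.val_last, Fin.val_castSucc]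
    omega
  · have := Fin.val_lt_last h
    rw [soloInformed_binaryWord_pair_getD _ _ _ (by omega) (by omega)]
    refine decide_eq_decide.mpr ?_
    simp only [Fin.ext_iff, Fin.val_last]
    omega

/-! ## 4. Linear extensions of the garland: the slot of the pendant determines everything -/

/-- On the chain the coordinate-to-slot map of a compatible `σ` is strictly increasing. -/
theorem soloInformed_sumCompat_strictMono {σ : Equiv.Perm (Fin (m + 4))}
    (hσ : soloInformedCompat (soloInformedSumPoset m) σ) :
    StrictMono (fun i : Fin (m + 3) => soloInformedCellPerm σ (Fin.castSucc i)) := by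
  refine Fin.strictMono_iff_lt_succ.2 fun j => ?_
  have h := hσ (Fin.castSucc j.succ, Fin.castSucc (Fin.castSucc j))
    (List.mem_append_left _ (List.mem_map.2 ⟨j, List.mem_finRange j, rfl⟩))
  exact Fin.rev_lt_rev.2 h

/-- The pendant sits strictly below the top coordinate `0`. -/
theorem soloInformed_sumCompat_pendant {σ : Equiv.Perm (Fin (m + 4))}
    (hσ : soloInformedCompat (soloInformedSumPoset m) σ) :
    soloInformedCellPerm σ 0 < soloInformedCellPerm σ (Fin.last (m + 3)) :=
  Fin.rev_lt_rev.2 (hσ (Fin.last (m + 3), 0) (List.mem_append_right _ (List.mem_singleton_self _)))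

/-- The slot of the pendant is not the top slot. -/
theorem soloInformed_sumCompat_slot_ne_zero {σ : Equiv.Perm (Fin (m + 4))}
    (hσ : soloInformedCompat (soloInformedSumPoset m) σ) :
    soloInformedCellPerm σ (Fin.last (m + 3)) ≠ 0 :=
  (lt_of_le_of_lt (Fin.zero_le _) (soloInformed_sumCompat_pendant hσ)).ne'

/-- A strictly increasing map `Fin k → Fin (k+1)` avoiding `s` is `Fin.succAbove s`. -/
theorem soloInformed_strictMono_eq_succAbove {k : ℕ} {f : Fin k → Fin (k + 1)} (hf : StrictMono f)
    {s : Fin (k + 1)} (hs : ∀ i, f i ≠ s) : f = Fin.succAbove s := by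
  have hcard : (Finset.univ.erase s).card = k := by
    rw [Finset.card_erase_of_mem (Finset.mem_univ _), Finset.card_univ, Fintype.card_fin]; rfl
  exact (Finset.orderEmbOfFin_unique hcard (fun i => Finset.mem_erase.2 ⟨hs i, Finset.mem_univ _⟩)
    hf).trans (Finset.orderEmbOfFin_unique hcard
      (fun i => Finset.mem_erase.2 ⟨Fin.succAbove_ne s i, Finset.mem_univ _⟩)
      (Fin.strictMono_succAbove s)).symm

/-- **The chain coordinate `i` sits at slot `succAbove s i`**, `s` the slot of the pendant. -/
theorem soloInformed_sumCompat_cellPerm_castSucc {σ : Equiv.Perm (Fin (m + 4))}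
    (hσ : soloInformedCompat (soloInformedSumPoset m) σ) (i : Fin (m + 3)) :
    soloInformedCellPerm σ (Fin.castSucc i) =
      Fin.succAbove (soloInformedCellPerm σ (Fin.last (m + 3))) i :=
  congr_fun (soloInformed_strictMono_eq_succAbove (soloInformed_sumCompat_strictMono hσ)
    fun i h => (Fin.castSucc_lt_last i).ne ((soloInformedCellPerm σ).injective h)) i

/-- The chain bottom sits at slot `q(s)`. -/
theorem soloInformed_sumCompat_cellPerm_csLast {σ : Equiv.Perm (Fin (m + 4))}
    (hσ : soloInformedCompat (soloInformedSumPoset m) σ) :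
    soloInformedCellPerm σ (Fin.castSucc (Fin.last (m + 2))) =
      soloInformedSumQslot (soloInformedCellPerm σ (Fin.last (m + 3))) := by
  rw [soloInformed_sumCompat_cellPerm_castSucc hσ, soloInformedSumQslot]
  split_ifs with h
  · rw [h, Fin.succAbove_last]
  · have := Fin.val_lt_last h
    rw [Fin.succAbove_of_le_castSucc _ _ (Fin.le_def.2 (by simp; omega)), Fin.succ_last]

/-! ## 5. The simplex piece of a linear extension is a double zeta value -/

/-- The piece of a linear extension lives on the cube cell `(0,1)ⁿ ∩ C_σ`. -/
theorem soloInformed_sumCellRep_domain {σ : Equiv.Perm (Fin (m + 4))}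
    (hσ : soloInformedCompat (soloInformedSumPoset m) σ) :
    (soloInformedCellRep (soloInformedSumGRep m) σ).domain =
      soloInformedOpenCube (m + 4) ∩ soloInformedCell σ := by
  rw [soloInformedCellRep_domain, soloInformedSumGRep_domain, soloInformedSumGarland]
  exact soloInformed_inter_orderSet_inter_cell hσ _

/-- **The simplex piece of a linear extension lives on Kontsevich's simplex.** -/
theorem soloInformed_sumPiece_domain {σ : Equiv.Perm (Fin (m + 4))}
    (hσ : soloInformedCompat (soloInformedSumPoset m) σ) :
    ((soloInformedCellRep (soloInformedSumGRep m) σ).reindex (soloInformedCellPerm σ)).domain =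
      openOrderedSimplex (m + 4) :=
  soloInformed_reindex_cubeCell_domain _ σ (soloInformed_sumCellRep_domain hσ)

/-- **The integrand of the simplex piece of `σ`** is the word-product of the attached index. -/
theorem soloInformed_sumPiece_integrand {σ : Equiv.Perm (Fin (m + 4))}
    (hσ : soloInformedCompat (soloInformedSumPoset m) σ) (w : Fin (m + 4) → ℝ) :
    ((soloInformedCellRep (soloInformedSumGRep m) σ).reindex (soloInformedCellPerm σ)).integrand w =
      ∏ k : Fin (m + 4), mzvForm ((MZV.binaryWord
        (soloInformedSumIdx m (soloInformedCellPerm σ (Fin.last (m + 3))))).getD k false) (w k) := by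
  have hs := soloInformed_sumCompat_slot_ne_zero hσ
  show soloInformedSumG (fun i => w (soloInformedCellPerm σ i)) = _
  unfold soloInformedSumG
  rw [← Equiv.prod_comp (soloInformedCellPerm σ) (fun k : Fin (m + 4) => mzvForm ((MZV.binaryWord
    (soloInformedSumIdx m (soloInformedCellPerm σ (Fin.last (m + 3))))).getD k false) (w k))]
  refine Finset.prod_congr rfl fun i _ => ?_
  congr 1
  rw [Bool.eq_iff_iff, soloInformed_sumIdx_getD hs, ← soloInformed_sumCompat_cellPerm_csLast hσ]
  simp only [soloInformedSumEps, decide_eq_true_eq, (soloInformedCellPerm σ).apply_eq_iff_eq]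
  exact or_comm

/-- **Each simplex piece IS a double zeta class**: `⟦(G|_{C_σ})∘cellPerm⟧ = mzvClass (idx s_σ)`. -/
theorem soloInformed_sumPiece_class {σ : Equiv.Perm (Fin (m + 4))}
    (hσ : soloInformedCompat (soloInformedSumPoset m) σ) :
    toFormalPeriod (of ((soloInformedCellRep (soloInformedSumGRep m) σ).reindex (soloInformedCellPerm σ))) =
      mzvClass (soloInformedSumIdx m (soloInformedCellPerm σ (Fin.last (m + 3)))) :=
  soloInformed_toFormalPeriod_eq_mzvClass (soloInformed_sumIdx_admissible
    (soloInformed_sumCompat_slot_ne_zero hσ)) (soloInformed_sumIdx_weight _) _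
    (soloInformed_sumPiece_domain hσ) (soloInformed_sumPiece_integrand hσ)

/-- The cell piece itself has the same class (rule (2) along the sorting permutation). -/
theorem soloInformed_sumCellRep_class {σ : Equiv.Perm (Fin (m + 4))}
    (hσ : soloInformedCompat (soloInformedSumPoset m) σ) :
    toFormalPeriod (of (soloInformedCellRep (soloInformedSumGRep m) σ)) =
      mzvClass (soloInformedSumIdx m (soloInformedCellPerm σ (Fin.last (m + 3)))) := by
  rw [← soloInformed_sumPiece_class hσ, toFormalPeriod_eq_iff]
  exact of_sub_of_reindex_mem_relations _ _

/-! ## 6. The bijection `σ ↔ s` between linear extensions and slots -/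

/-- The slot permutation attached to `s`: `castSucc i ↦ succAbove s i`, `last ↦ s`. -/
def soloInformedSlotPerm (s : Fin (m + 4)) : Equiv.Perm (Fin (m + 4)) :=
  finSuccEquivLast.trans (finSuccEquiv' s).symm

/-- Auxiliary (sum pieces): `soloInformed_slotPerm_last`. -/
@[simp] theorem soloInformed_slotPerm_last (s : Fin (m + 4)) :
    soloInformedSlotPerm s (Fin.last (m + 3)) = s := by
  simp [soloInformedSlotPerm, finSuccEquivLast_last, finSuccEquiv'_symm_none]

/-- Auxiliary (sum pieces): `soloInformed_slotPerm_castSucc`. -/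
@[simp] theorem soloInformed_slotPerm_castSucc (s : Fin (m + 4)) (i : Fin (m + 3)) :
    soloInformedSlotPerm s (Fin.castSucc i) = Fin.succAbove s i := by
  simp [soloInformedSlotPerm, finSuccEquivLast_castSucc, finSuccEquiv'_symm_some]

/-- The linear extension attached to the slot `s` (as a cell label `σ`). -/
def soloInformedSumSigma (s : Fin (m + 4)) : Equiv.Perm (Fin (m + 4)) :=
  Fin.revPerm.trans (soloInformedSlotPerm s).symm

/-- Its coordinate-to-slot map is the slot permutation. -/
theorem soloInformed_cellPerm_sumSigma (s : Fin (m + 4)) :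
    soloInformedCellPerm (soloInformedSumSigma s) = soloInformedSlotPerm s := by
  refine Equiv.ext fun i => ?_
  simp [soloInformedCellPerm, soloInformedSumSigma]

/-- `σ_s` is a linear extension of the garland poset (for `s ≠ 0`). -/
theorem soloInformed_sumCompat_sumSigma {s : Fin (m + 4)} (hs : s ≠ 0) :
    soloInformedCompat (soloInformedSumPoset m) (soloInformedSumSigma s) := by
  have key : ∀ a b : Fin (m + 4), soloInformedSlotPerm s b < soloInformedSlotPerm s a →
      (soloInformedSumSigma s).symm a < (soloInformedSumSigma s).symm b := fun a b h => by
    have e : ∀ x, (soloInformedSumSigma s).symm x = Fin.rev (soloInformedSlotPerm s x) := fun x => by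
      simp [soloInformedSumSigma]
    rw [e, e]
    exact Fin.rev_lt_rev.2 h
  intro p hp
  rcases List.mem_append.1 hp with hp | hp
  · obtain ⟨j, -, rfl⟩ := List.mem_map.1 hp
    apply key
    simp only [soloInformed_slotPerm_castSucc]
    exact Fin.strictMono_succAbove s Fin.castSucc_lt_succ
  · rw [List.mem_singleton.1 hp]
    apply key
    have h0 : soloInformedSlotPerm s 0 = 0 := by
      simpa [Fin.succAbove_ne_zero_zero hs] using soloInformed_slotPerm_castSucc s 0
    rw [h0, soloInformed_slotPerm_last]
    exact Fin.pos_of_ne_zero hs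

/-- **A linear extension is determined by the slot of its pendant**: `σ = σ_{s(σ)}`. -/
theorem soloInformed_sumCompat_eq_sumSigma {σ : Equiv.Perm (Fin (m + 4))}
    (hσ : soloInformedCompat (soloInformedSumPoset m) σ) :
    σ = soloInformedSumSigma (soloInformedCellPerm σ (Fin.last (m + 3))) := by
  have h : soloInformedCellPerm σ = soloInformedSlotPerm (soloInformedCellPerm σ (Fin.last (m + 3))) := by
    refine Equiv.ext fun i => ?_
    rcases Fin.eq_castSucc_or_eq_last i with ⟨j, rfl⟩ | rfl
    · rw [soloInformed_slotPerm_castSucc, soloInformed_sumCompat_cellPerm_castSucc hσ]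
    · rw [soloInformed_slotPerm_last]
  refine Equiv.ext fun i => ?_
  show σ i = (soloInformedSlotPerm _).symm (Fin.revPerm i)
  rw [Equiv.eq_symm_apply, ← h]
  simp [soloInformedCellPerm]

/-- **Re-indexing a sum over the linear extensions by the slot of the pendant.** -/
theorem soloInformed_sum_sumCompat_eq {α : Type*} [AddCommMonoid α] (F : Fin (m + 4) → α) :
    ∑ σ ∈ Finset.univ.filter (soloInformedCompat (soloInformedSumPoset m)),
      F (soloInformedCellPerm σ (Fin.last (m + 3))) = ∑ s ∈ Finset.univ.erase (0 : Fin (m + 4)), F s := by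
  refine Finset.sum_nbij' (fun σ => soloInformedCellPerm σ (Fin.last (m + 3)))
    (fun s => soloInformedSumSigma s) (fun σ hσ => ?_) (fun s hs => ?_) (fun σ hσ => ?_)
    (fun s hs => ?_) fun _ _ => rfl
  · exact Finset.mem_erase.2
      ⟨soloInformed_sumCompat_slot_ne_zero (Finset.mem_filter.1 hσ).2, Finset.mem_univ _⟩
  · exact Finset.mem_filter.2
      ⟨Finset.mem_univ _, soloInformed_sumCompat_sumSigma (Finset.mem_erase.1 hs).1⟩
  · exact (soloInformed_sumCompat_eq_sumSigma (Finset.mem_filter.1 hσ).2).symm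
  · simp [soloInformed_cellPerm_sumSigma]

/-! ## 7. The class of the left-hand side of the telescope step -/

/-- **`⟦G⟧ = ∑_{s ≠ 0} mzvClass (idx s)`.** -/
theorem soloInformed_sumG_class : toFormalPeriod (of (soloInformedSumGRep m)) =
    ∑ s ∈ Finset.univ.erase (0 : Fin (m + 4)), mzvClass (soloInformedSumIdx m s) := by
  rw [← soloInformed_sum_sumCompat_eq (fun s => mzvClass (soloInformedSumIdx m s)),
    toFormalPeriod_eq_iff.2 soloInformed_sumG_dissect, map_sum]
  exact Finset.sum_congr rfl fun σ hσ => soloInformed_sumCellRep_class (Finset.mem_filter.1 hσ).2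

/-- **`⟦R₁⟧ = ∑_{s ≠ 0} mzvClass (idx s)`**: the left-hand side of the telescope step is the sum
of `Z(m+3, 1)` and the `Z(s+1, m+3−s)`, `1 ≤ s ≤ m+2`, in the formal period ring. -/
theorem soloInformed_sum_R1_class : toFormalPeriod (of (soloInformedSumDatum m).R1) =
    ∑ s ∈ Finset.univ.erase (0 : Fin (m + 4)), mzvClass (soloInformedSumIdx m s) := by
  rw [← soloInformed_sumG_class, toFormalPeriod_eq_iff]
  exact soloInformed_sum_moveA

end Summit.KontsevichZagierPeriods.KontsevichZagierPeriods.Theorems
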